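import Mathlib

/-!
# `BalabanUV.Beta.GroupMeanGaugeCoordinates` — binder row D1, RULING R-D1-g25-3 step S1g: THE RESIDUAL GAUGE GROUP ACTS ON THE GROUP-MEAN GAUGE
# COORDINATES BY RIGHT TRANSLATION, so on the sharp group-mean slice the Faddeev–Popov map is INVERSION — background-independent, a bijection
# («FP ≡ 1») — for ANY mean with the two-sided equivariance [Balaban1987RG1] (0.6)

HONEST FRAMING (cell contract, verbatim): «discharging `BetaPertH` makes Bałaban's UV stability UNCONDITIONAL — a real constructive-QFT
result; it is NOT the continuum limit and NOT the Clay problem.»  THIS MODULE DISCHARGES NOTHING of `BetaPertH` ∕ row D1: [folklore] group algebra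
(three-line identities).  0 sorry, 0 `def … : Prop`, nothing cited as a fact; quotations are OBJECT LOCATORS.

WHAT.  [Balaban1987RG1] p.253: the group mean `M({U_j})` with (0.6) `M({uU_jv}) = uM({U_j})v`, the averaged contour variables (0.11)
`U(y,x) = M({U(Γ)}_{Γ∈G(y,x)})`; p.254–255 (0.14)–(0.16): gauge fixing in these coordinates, «we change the order of integrations and apply the gauge
transformation U → U^u with u(y) = 1 for y ∈ T^{(1)}. By the gauge invariance with respect to such transformations the integrand does not depend on u and
the integral over u is equal to 1.»  TYPED HERE (abstractly, for a group `G`, an index type `ι` of contours and ANY `M : (ι → G) → G` with the two-sided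
law (0.6) — `EquivariantMean`): a residual gauge transformation `u` (value `u_r` at the root `r(y)`, `u_x` at `x`) sends every holonomy `U(Γ)`, `Γ : r(y) → x`,
to `u_r · U(Γ) · u_x⁻¹`, hence (`gaugeCoord_transform`) `U(y,x) ↦ u_r · U(y,x) · u_x⁻¹`; for the RESIDUAL group (`u_r = 1`): RIGHT TRANSLATION by `u_x⁻¹`
(`gaugeCoord_residual`).  Consequently the Faddeev–Popov map of the sharp slice `U(y,x) = 1` at a configuration ON the slice, `u_x ↦ U^u(y,x) = u_x⁻¹`, is
INVERSION — independent of the configuration (`fp_map_on_slice`) — and for every configuration the equation `U^u(y,x) = 1` has the unique solution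
`u_x = U(y,x)` (`existsUnique_residual`): the u-integral of p.255 with δ in place of the exponential weight is 1 by Haar translation-invariance [analysis:
the measure statement is not typed here; the typed content is the bijection ∕ configuration-independence].  This is R-D1-g25-3 (2)(i)–(ii) as a kernel
fact: the group-mean slice of the re-based literal «JsB12Sym» carries NO Faddeev–Popov row at any loop order.  NOT D1, NOT BetaPertH, NOT continuum, NOT Clay.
HONEST DEPENDENCY (verbatim): «continuum YM on T⁴ ⇐ BetaPertH ∧ nine spine estimates (0/9 proved); BetaPertH ⇐ (D1) ∧ (D4) ∧ CAP+tail;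
G-an2-4 gates asym, D1 and NE2/3/4.»  ABSOLUTE RULE (cell, verbatim): «No internally-minted statement may enter as a cited fact. Every
hypothesis is either kernel-proved in this package or a verbatim quotation of a PUBLISHED theorem with page reference.»
Unit `b2b-balaban-beta-an2` gen 25 (row-D1 owner), 2026-08-21.
-/

namespace Summit.QuantumFields.BalabanUV.Beta.GroupMeanGaugeCoordinates

/-- [our object] **A GROUP MEAN WITH THE TWO-SIDED EQUIVARIANCE (0.6)** `M({u·U_j·v}) = u·M({U_j})·v` — the only property of [Balaban1987RG1]'s
`M` (p.253 (0.5)–(0.10)) that the gauge-coordinate argument uses.  A structure of DATA + one law; nothing about existence or smallness domains. -/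
structure EquivariantMean (ι G : Type*) [Group G] where
  /-- the mean of a family of group elements indexed by the contours -/
  M : (ι → G) → G
  /-- (0.6): two-sided equivariance -/
  equivariant : ∀ (U : ι → G) (u v : G), M (fun i => u * U i * v) = u * M U * v

variable {ι G : Type*} [Group G]

namespace EquivariantMean

/-- [folklore] Right equivariance alone: `M({U_j·v}) = M({U_j})·v`. -/
theorem right (μ : EquivariantMean ι G) (U : ι → G) (v : G) : μ.M (fun i => U i * v) = μ.M U * v := by
  simpa using μ.equivariant U 1 v

/-- [folklore] Left equivariance alone: `M({u·U_j}) = u·M({U_j})`. -/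
theorem left (μ : EquivariantMean ι G) (U : ι → G) (u : G) : μ.M (fun i => u * U i) = u * μ.M U := by
  simpa using μ.equivariant U u 1

/-- [our object] **THE GAUGE COORDINATE** `U(y,x) := M({U(Γ)}_{Γ})` of a family of holonomies ([Balaban1987RG1] (0.11)). -/
def gaugeCoord (μ : EquivariantMean ι G) (hol : ι → G) : G := μ.M hol

/-- [folklore] **A GAUGE TRANSFORMATION ACTS ON THE GAUGE COORDINATE BY `u_r · U(y,x) · u_x⁻¹`** — because it acts so on EVERY holonomy from the root
`r(y)` to `x` (`U(Γ)^u = u(r) U(Γ) u(x)⁻¹` for every contour `Γ : r → x`) and `M` is two-sidedly equivariant. -/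
theorem gaugeCoord_transform (μ : EquivariantMean ι G) (hol : ι → G) (ur ux : G) :
    μ.gaugeCoord (fun i => ur * hol i * ux⁻¹) = ur * μ.gaugeCoord hol * ux⁻¹ :=
  μ.equivariant hol ur ux⁻¹

/-- [folklore] **THE RESIDUAL GROUP (`u = 1` at the roots) ACTS BY RIGHT TRANSLATION**: `U(y,x) ↦ U(y,x) · u_x⁻¹`. -/
theorem gaugeCoord_residual (μ : EquivariantMean ι G) (hol : ι → G) (ux : G) :
    μ.gaugeCoord (fun i => hol i * ux⁻¹) = μ.gaugeCoord hol * ux⁻¹ :=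
  μ.right hol ux⁻¹

/-- [folklore] **ON THE SHARP SLICE `U(y,x) = 1` THE FADDEEV–POPOV MAP IS INVERSION** — `u_x ↦ U^u(y,x) = u_x⁻¹`, the SAME map for every configuration
on the slice (background-independence; R-D1-g25-3 (2)(ii)). -/
theorem fp_map_on_slice (μ : EquivariantMean ι G) {hol : ι → G} (hslice : μ.gaugeCoord hol = 1) (ux : G) :
    μ.gaugeCoord (fun i => hol i * ux⁻¹) = ux⁻¹ := by
  rw [gaugeCoord_residual, hslice, one_mul]

/-- [folklore] **UNIQUE RESIDUAL GAUGE FIXING**: for EVERY family of holonomies there is exactly one residual value `u_x` putting the coordinate on the slice,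
namely `u_x = U(y,x)` (R-D1-g25-3 (2)(i): the δ-version of «the integral over u is equal to 1»). -/
theorem existsUnique_residual (μ : EquivariantMean ι G) (hol : ι → G) :
    ∃! ux : G, μ.gaugeCoord (fun i => hol i * ux⁻¹) = 1 := by
  refine ⟨μ.gaugeCoord hol, ?_, ?_⟩
  · show μ.gaugeCoord (fun i => hol i * (μ.gaugeCoord hol)⁻¹) = 1
    rw [gaugeCoord_residual, mul_inv_cancel]
  · intro v hv
    rw [gaugeCoord_residual, mul_inv_eq_one] at hv
    exact hv.symm

/-- [folklore] The residual action is free and transitive on the coordinate: `U(y,x)·u_x⁻¹ = U(y,x)·v_x⁻¹ ↔ u_x = v_x`. -/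
theorem residual_injective (μ : EquivariantMean ι G) (hol : ι → G) :
    Function.Injective fun ux : G => μ.gaugeCoord (fun i => hol i * ux⁻¹) := by
  intro u v h
  simp only [gaugeCoord_residual, mul_right_inj, inv_inj] at h
  exact h

end EquivariantMean

/-! ## An inhabitant: the two-sided law holds for the «first contour» mean (so the structure is consistent; the printed inhabitants (0.10)∕(0.4)'s
exp-log mean need the analytic smallness domain and are the T4 side's `BlockAveraging.LoopAverage` business) -/

/-- [folklore] Picking one contour is an equivariant «mean» (the single-comb case [Balaban1985Averaging]: `U(y,x) = U(Γ_{y,x})`). -/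
def EquivariantMean.single {ι G : Type*} [Group G] (i₀ : ι) : EquivariantMean ι G where
  M U := U i₀
  equivariant _ _ _ := rfl

end Summit.QuantumFields.BalabanUV.Beta.GroupMeanGaugeCoordinates
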